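import Summits.RiemannHypothesis.RiemannHypothesis.Theorems.TiltedLandingLaw421R3Lens1ArcSignI

/-!
# TiltedLandingLaw421R3 — lens-1 (part J): the ATOMIC SPLIT of the crossing-mate residual

LENS-1 gen-7 module image `rh33346-cover/lens-1/AtomicSplit-v1.lean` (landing target `…/Theorems/TiltedLandingLaw421R3Lens1ArcSignJ.lean`; single
import = part I; namespace `RhW08.Lens1ArcSign`; 0 `sorry`, no instances / notation).  SUMMON (O7-1)/(O7-3) of director-rh g25 after (CA656)/(CA668):
SHAPE v2 («≤ 1 net-ascending bad piece») is DEAD on the full residual (W7, cluster `P = 3`, two ascending pieces) but ALIVE on the ATOMIC class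
(`P = 2`: C6 g38 seal census 0 / 522 885); so the residual `TopPinningNonNestedAscResidual` (part I) is split by cluster size.

CONTENT. §1 MATES and the ATOMIC class: `IsMate` (= the negation of `JensenIsolated`ʼs clause at one zero), `OffChain`, `Atomic f j a v` («`v` is the
ONE interior crossing mate of `a` and the cluster is exactly `{a, v}`»), `AscLeOne` / `NetLeOne` (the shape in part Fʼs sign-word currency: on every small
circle outside finitely many radii, `#asc ≤ 1`, resp. `#asc ≤ #desc + 1`), ★ `AtomicShapeLawQ`, `AtomicNetLawQ`, ★ `NonAtomicTopResidualQ`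
(statements) · §2 `two_mul_card_le_nonrealZeroMult`, `four_le_nonrealZeroMult` (an interior second upper zero gives `N ≥ 4`, PROVED) · §3 ★ RUNG 4
`pinning_of_netLeOne` (PROVED: interior second upper zero + `NetLeOne` ⇒ the disjunction, by part Hʼs CONVERSION) · §4 ★ the PROVED glued split
`topPinningResidual_of_split : AtomicShapeLawQ → NonAtomicTopResidualQ → TopPinningNonNestedAscResidual` (and `topPinning_of_split`) · §5 ☆ PIN-P3
candidate `CentralChildDiscQ` (statement only; binder of nothing).

«ATOMIC» PRECISELY (= C6ʼs census class, seal g38): `v ≠ a` is an upper zero of the same `f^{(j)}` with `‖v − Re a‖ ≤ Im a` (INTERIOR: inside or on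
`a`ʼs Jensen circle), `Im a ≤ |Re a − Re v| + Im v` (not strictly nested: `v`ʼs closed Jensen disc reaches `a`ʼs circle — a CROSSING mate), and every
third upper zero is strictly disc-apart from both `a` and `v` (OFF-CHAIN; so the cluster of `a` is `{a, v}` and nothing is nested in either).
«NET-ASCENDING PIECE» PRECISELY: an element of part Fʼs `ascStarts f j a δ` (a bad piece of the circle `|w − Re a| = Im a + δ` entered with `Re φ < 0` and
left with `Re φ > 0`); «in J»: on the atomic class every bad point of a small circle lies in the lens `J = C ∩ D_v` (gen-7 memo, lemma BadInLens — not
part of the typed law, which only counts).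

HONEST LABEL / PRICE: the split is EXACT bookkeeping plus ONE proved rung (RUNG 4); it prices the atomic class DOWN TO a pure sign-word statement
(`AscLeOne`), it does not prove it.  `AtomicShapeLawQ`, `NonAtomicTopResidualQ`, `TopPinning`, 33346, 33347 OPEN; nothing here bears on the truth of
RH; RH is not proved; checked ≠ landed ≠ proved.
-/

noncomputable section

namespace RhW08.Lens1ArcSign

open Complex Set Metric Filter Topology
open scoped Real
open Literature.Topology.PlaneTopology Literature.Analysis.Complex
open Summit.RiemannHypothesis.RiemannHypothesis.Theorems.Splittings.JensenWindow
open RhIdea6.G17.W07C7 RhIdea6.G17.W07C7.Rev6 RhIdea6.G18.W07C8.Law421BirthS RhIdea6.G19.W07C11.Seam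
open RhIdea6.G20.W07C12.Frac RhIdea6.G20.W07C12.StColP RhW07.C12.FieldSplit RhIdea6.G21.W07C13.TentMax
open RhW07.C14.TwoSided RhW07.C14.Classes RhW07.C14.Lineage RhW07.C14.Booking
open RhW07.C13.Heredity RhIdea6.G22.W07C15pre.Injection RhW07.E3.Cell RhW07.E3.Lit
open RhW08.Round1 RhW08.StSwap RhW08.Round2 RhW08.QuadW RhW08.SealSwapQ RhW08.SealSwap RhW08.SuccB RhW08.SuccSplit
open RhW08.SuccTheft RhW08.Column RhW08.Hurwitz RhW08.ClusterQ RhW08.ClusterQM RhW08.NewtonDoor RhW08.NewtonDoorGenusOne RhW08.PurseP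
open RhW08.Lens1SignCut RhW08.Lens1Coverage RhW08.IsolatedTilt RhW08.Lens1Pinning RhW08.Lens1PinningIso

/-! ## §1 Mates, the atomic class, the shape laws -/

/-- `c` is a MATE of the upper zero `a` of `f^{(j)}`: another upper zero whose closed Jensen disc is neither strictly apart from `a`ʼs nor strictly
nested in it — the negation of `JensenIsolated`ʼs clause at `c`. -/
def IsMate (f : ℂ → ℂ) (j : ℕ) (a c : ℂ) : Prop :=
  iteratedDeriv j f c = 0 ∧ 0 < c.im ∧ c ≠ a ∧ ¬ (a.im + c.im < |a.re - c.re| ∨ |a.re - c.re| + c.im < a.im)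

/-- `¬ JensenIsolated` = some mate exists. -/
theorem exists_isMate_of_not_jensenIsolated {f : ℂ → ℂ} {j : ℕ} {a : ℂ} (hJ : ¬ JensenIsolated f j a) : ∃ c, IsMate f j a c := by
  by_contra h
  push Not at h
  exact hJ fun c hc hcpos hca => by
    by_contra hnot
    exact h c ⟨hc, hcpos, hca, hnot⟩

theorem not_jensenIsolated_of_isMate {f : ℂ → ℂ} {j : ℕ} {a c : ℂ} (h : IsMate f j a c) : ¬ JensenIsolated f j a :=
  fun hJ => h.2.2.2 (hJ c h.1 h.2.1 h.2.2.1)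

/-- OFF-CHAIN: every upper zero of `f^{(j)}` other than `a`, `v` is strictly disc-apart from both. -/
def OffChain (f : ℂ → ℂ) (j : ℕ) (a v : ℂ) : Prop :=
  ∀ c : ℂ, iteratedDeriv j f c = 0 → 0 < c.im → c ≠ a → c ≠ v → a.im + c.im < |a.re - c.re| ∧ v.im + c.im < |v.re - c.re|

/-- ★ ATOMIC: `v` is the ONE INTERIOR CROSSING MATE of `a` and the cluster is exactly `{a, v}` (module docstring). -/
def Atomic (f : ℂ → ℂ) (j : ℕ) (a v : ℂ) : Prop :=
  iteratedDeriv j f v = 0 ∧ 0 < v.im ∧ v ≠ a ∧ ‖v - (a.re : ℂ)‖ ≤ a.im ∧ a.im ≤ |a.re - v.re| + v.im ∧ OffChain f j a v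

/-- The atomic mate is a mate … -/
theorem isMate_of_atomic {f : ℂ → ℂ} {j : ℕ} {a v : ℂ} (hA : Atomic f j a v) : IsMate f j a v := by
  obtain ⟨hv, hvpos, hva, hvin, hnn, -⟩ := hA
  refine ⟨hv, hvpos, hva, ?_⟩
  have h1 : |a.re - v.re| ≤ ‖v - (a.re : ℂ)‖ := by
    have := abs_re_le_norm (v - (a.re : ℂ))
    rw [sub_re, ofReal_re, abs_sub_comm] at this
    exact this
  rintro (h | h) <;> linarith

/-- … and the only one. -/
theorem eq_of_isMate_of_atomic {f : ℂ → ℂ} {j : ℕ} {a v c : ℂ} (hA : Atomic f j a v) (hc : IsMate f j a c) : c = v := by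
  by_contra hcv
  exact hc.2.2.2 (Or.inl (hA.2.2.2.2.2 c hc.1 hc.2.1 hc.2.2.1 hcv).1)

/-- SHAPE v3 in part Fʼs currency: on every small Jensen circle of `a` outside finitely many radii there is AT MOST ONE net-ascending bad piece. -/
def AscLeOne (f : ℂ → ℂ) (j : ℕ) (a : ℂ) : Prop :=
  ∃ d0 > 0, ∃ E : Set ℝ, E.Finite ∧ ∀ δ ∈ Ioo 0 d0 \ E, (ascStarts f j a δ).Finite ∧ (ascStarts f j a δ).ncard ≤ 1

/-- Its NET weakening (all the split consumes): `#asc ≤ #desc + 1` on the same circles. -/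
def NetLeOne (f : ℂ → ℂ) (j : ℕ) (a : ℂ) : Prop :=
  ∃ d0 > 0, ∃ E : Set ℝ, E.Finite ∧ ∀ δ ∈ Ioo 0 d0 \ E, (ascStarts f j a δ).Finite ∧ (ascStarts f j a δ).ncard ≤ (descStarts f j a δ).ncard + 1

theorem netLeOne_of_ascLeOne {f : ℂ → ℂ} {j : ℕ} {a : ℂ} (h : AscLeOne f j a) : NetLeOne f j a := by
  obtain ⟨d0, hd0, E, hE, hA⟩ := h
  exact ⟨d0, hd0, E, hE, fun δ hδ => ⟨(hA δ hδ).1, (hA δ hδ).2.trans (by omega)⟩⟩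

/-- ★ THE ATOMIC SHAPE LAW (OPEN; census 0 / 522 885, C6 seal g38): on a legal frame, a top (`NoTallerToucher`) upper zero `a` of `f^{(j)}` with an
ATOMIC mate `v`, both simple, has at most one net-ascending bad piece on every small Jensen circle outside finitely many radii. -/
def AtomicShapeLawQ : Prop :=
  ∀ (η : ℝ) (f : ℂ → ℂ) (x₀ s hmax R Hs : ℝ) (B : ℕ), EngineHyps5 2 η f x₀ s hmax R Hs B → ∀ (j : ℕ) (a v : ℂ),
    iteratedDeriv j f a = 0 → 0 < a.im → NoTallerToucher f j a → Atomic f j a v →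
    iteratedDeriv (j + 1) f a ≠ 0 → iteratedDeriv (j + 1) f v ≠ 0 → AscLeOne f j a

/-- Its net form (OPEN, weaker). -/
def AtomicNetLawQ : Prop :=
  ∀ (η : ℝ) (f : ℂ → ℂ) (x₀ s hmax R Hs : ℝ) (B : ℕ), EngineHyps5 2 η f x₀ s hmax R Hs B → ∀ (j : ℕ) (a v : ℂ),
    iteratedDeriv j f a = 0 → 0 < a.im → NoTallerToucher f j a → Atomic f j a v →
    iteratedDeriv (j + 1) f a ≠ 0 → iteratedDeriv (j + 1) f v ≠ 0 → NetLeOne f j a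

theorem atomicNetLaw_of_atomicShapeLaw (h : AtomicShapeLawQ) : AtomicNetLawQ :=
  fun η f x₀ s hmax R Hs B hE j a v ha hapos hN hA hda hdv => netLeOne_of_ascLeOne (h η f x₀ s hmax R Hs B hE j a v ha hapos hN hA hda hdv)

/-- ★ THE NON-ATOMIC RESIDUAL (OPEN): part Iʼs residual `TopPinningNonNestedAscResidual` restricted to tops with NO atomic mate — i.e. cluster size
`P ≥ 3` (two distinct mates, or a third zero chained to the mate), or the unique mate is EXTERIOR (`‖v − Re a‖ > Im a`). -/
def NonAtomicTopResidualQ : Prop :=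
  ∀ (η : ℝ) (f : ℂ → ℂ) (x₀ s hmax R Hs : ℝ) (B : ℕ), EngineHyps5 2 η f x₀ s hmax R Hs B → ∀ (j : ℕ) (a : ℂ),
    iteratedDeriv j f a = 0 → 0 < a.im → NoTallerToucher f j a → ¬ JensenIsolated f j a → ¬ ArcSignClear f j a → ¬ ArcNoAsc f j a →
    ¬ ArcNetNonAsc f j a → (∀ u : ℂ, iteratedDeriv j f u = 0 → 0 < u.im → NestedIn a u → ¬ ArcNetNonAsc f j u) →
    (∀ v : ℂ, ¬ Atomic f j a v) →
    (∃ w : ℂ, iteratedDeriv (j + 1) f w = 0 ∧ w.im ≠ 0 ∧ NestedStep a w) ∨ (∃ x : ℝ, |x - a.re| ≤ a.im ∧ NLEventOf f j x)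

/-! ## §2 An interior second upper zero gives `N ≥ 4` -/

/-- Upper zeros of a real entire `G ≢ 0` in a disc centred on `ℝ` count twice in `nonrealZeroMult` (they and their conjugates). -/
theorem two_mul_card_le_nonrealZeroMult {G : ℂ → ℂ} (hG : Differentiable ℂ G) (hne : G ≠ 0) (hreal : ∀ x : ℝ, (G x).im = 0)
    {c r : ℝ} (hr : 0 < r) (S : Finset ℂ) (hS : ∀ ρ ∈ S, G ρ = 0 ∧ 0 < ρ.im ∧ ρ ∈ ball (c : ℂ) r) :
    2 * (S.card : ℤ) ≤ nonrealZeroMult G c r := by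
  classical
  set L : ℝ := r + 1 with hL
  have hz₀ : ((c : ℂ)) ∈ Ioo (c - L) (c + L) ×ℂ Ioo (-(r + 1)) (r + 1) :=
    ofReal_mem_box (by rw [sub_self, abs_zero]; linarith) hr.le
  have hfin : {ρ : ℂ | G ρ = 0 ∧ ρ ∈ ball (c : ℂ) r ∧ ρ.im ≠ 0}.Finite := by
    refine (finite_zeros_box hG hne hz₀).subset ?_
    rintro ρ ⟨h0, hρ, -⟩
    refine ⟨h0, ?_⟩
    rw [mem_ball, dist_eq_norm] at hρ
    have h1 := abs_re_le_norm (ρ - (c : ℂ))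
    have h2 := abs_im_le_norm (ρ - (c : ℂ))
    rw [sub_re, ofReal_re, abs_le] at h1
    rw [sub_im, ofReal_im, sub_zero, abs_le] at h2
    exact mem_reProdIm.2 ⟨⟨by linarith [h1.1], by linarith [h1.2]⟩, ⟨by linarith [h2.1], by linarith [h2.2]⟩⟩
  have hconj : ∀ ρ ∈ ball ((c : ℝ) : ℂ) r, (starRingEnd ℂ) ρ ∈ ball ((c : ℝ) : ℂ) r := by
    intro ρ hρ
    rw [mem_ball, dist_eq_norm] at hρ ⊢
    have e : (starRingEnd ℂ) ρ - (c : ℂ) = (starRingEnd ℂ) (ρ - (c : ℂ)) := by rw [map_sub, Complex.conj_ofReal]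
    rw [e, Complex.norm_conj]
    exact hρ
  have hSsub : S ⊆ hfin.toFinset := by
    intro ρ hρ
    rw [Set.Finite.mem_toFinset]
    obtain ⟨h0, hpos, hb⟩ := hS ρ hρ
    exact ⟨h0, hb, hpos.ne'⟩
  have hS'sub : S.image (starRingEnd ℂ) ⊆ hfin.toFinset := by
    intro ρ hρ
    rw [Finset.mem_image] at hρ
    obtain ⟨σ, hσ, rfl⟩ := hρ
    obtain ⟨h0, hpos, hb⟩ := hS σ hσ
    rw [Set.Finite.mem_toFinset]
    refine ⟨by rw [apply_conj_eq_conj hG hreal, h0, map_zero], hconj σ hb, ?_⟩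
    simpa using hpos.ne'
  have hdisj : Disjoint S (S.image (starRingEnd ℂ)) := by
    rw [Finset.disjoint_left]
    intro ρ hρ hρ'
    rw [Finset.mem_image] at hρ'
    obtain ⟨σ, hσ, hσρ⟩ := hρ'
    have h1 := (hS ρ hρ).2.1
    have h2 := (hS σ hσ).2.1
    have h3 : ρ.im = -σ.im := by rw [← hσρ]; simp
    linarith
  have hU : S ∪ S.image (starRingEnd ℂ) ⊆ hfin.toFinset := Finset.union_subset hSsub hS'sub
  have hcard : ((S ∪ S.image (starRingEnd ℂ)).card : ℤ) = 2 * S.card := by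
    rw [Finset.card_union_of_disjoint hdisj, Finset.card_image_of_injective _ (starRingEnd ℂ).injective]
    push_cast
    ring
  have hpos : ∀ ρ ∈ hfin.toFinset, 0 < (meromorphicOrderAt G ρ).untop₀ := by
    intro ρ hρ
    rw [Set.Finite.mem_toFinset] at hρ
    exact untop₀_order_pos hG hne hρ.1
  unfold nonrealZeroMult
  rw [finsum_mem_eq_finite_toFinset_sum _ hfin]
  have h1 := Finset.sum_le_sum_of_subset_of_nonneg hU (fun ρ hρ _ => (hpos ρ hρ).le)
  have h2 : (S ∪ S.image (starRingEnd ℂ)).card • (1 : ℤ) ≤ ∑ ρ ∈ S ∪ S.image (starRingEnd ℂ), (meromorphicOrderAt G ρ).untop₀ :=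
    Finset.card_nsmul_le_sum _ _ 1 fun ρ hρ => by have := hpos ρ (hU hρ); omega
  rw [nsmul_eq_mul, mul_one] at h2
  linarith

/-- `a` lies in each of its enlarged Jensen discs. -/
theorem self_mem_ball {a : ℂ} (hapos : 0 < a.im) {δ : ℝ} (hδ : 0 < δ) : a ∈ ball ((a.re : ℝ) : ℂ) (a.im + δ) := by
  rw [mem_ball, dist_eq_norm]
  have e : a - (a.re : ℂ) = ((a.im : ℝ) : ℂ) * I := Complex.ext (by simp) (by simp)
  rw [e, norm_mul, Complex.norm_real, Complex.norm_I, mul_one, Real.norm_eq_abs, abs_of_pos hapos]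
  linarith

/-- ★ `N ≥ 4` on every disc `|w − Re a| < Im a + δ` when a SECOND upper zero `v ≠ a` of the real entire `G ≢ 0` lies in `‖v − Re a‖ ≤ Im a`. -/
theorem four_le_nonrealZeroMult {G : ℂ → ℂ} (hG : Differentiable ℂ G) (hne : G ≠ 0) (hreal : ∀ x : ℝ, (G x).im = 0) {a v : ℂ}
    (ha : G a = 0) (hapos : 0 < a.im) (hv : G v = 0) (hvpos : 0 < v.im) (hva : v ≠ a) (hvin : ‖v - (a.re : ℂ)‖ ≤ a.im) {δ : ℝ}
    (hδ : 0 < δ) : 4 ≤ nonrealZeroMult G a.re (a.im + δ) := by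
  classical
  have hr : 0 < a.im + δ := by linarith
  have hvball : v ∈ ball ((a.re : ℝ) : ℂ) (a.im + δ) := by
    rw [mem_ball, dist_eq_norm]
    linarith
  have h := two_mul_card_le_nonrealZeroMult hG hne hreal hr {a, v} (by
    intro ρ hρ
    rcases Finset.mem_insert.1 hρ with rfl | hρ
    · exact ⟨ha, hapos, self_mem_ball hapos hδ⟩
    · rw [Finset.mem_singleton.1 hρ]
      exact ⟨hv, hvpos, hvball⟩)
  rw [Finset.card_pair hva.symm] at h
  push_cast at h
  linarith

/-! ## §3 RUNG 4: an interior second zero and `NetLeOne` give the disjunction -/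

/-- ★★★ RUNG 4 (PROVED).  On a legal frame, an upper zero `a` of `f^{(j)}` with a SECOND upper zero `v ≠ a` in `‖v − Re a‖ ≤ Im a` and with
`#asc ≤ #desc + 1` on every small Jensen circle outside finitely many radii has a non-real zero of `f^{(j+1)}` in its closed Jensen disc or an NL event of
level `j` in its closed base: `N ≥ 4` (§2) turns `#asc − #desc ≤ 1` into the count law `2(#asc − #desc) ≤ N − 2`, and part Hʼs CONVERSION concludes. -/
theorem pinning_of_netLeOne {η : ℝ} {f : ℂ → ℂ} {x₀ s hmax R Hs : ℝ} {B : ℕ} (hE : EngineHyps5 2 η f x₀ s hmax R Hs B) {j : ℕ} {a v : ℂ}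
    (ha : iteratedDeriv j f a = 0) (hapos : 0 < a.im) (hv : iteratedDeriv j f v = 0) (hvpos : 0 < v.im) (hva : v ≠ a)
    (hvin : ‖v - (a.re : ℂ)‖ ≤ a.im) (hN : NetLeOne f j a) :
    (∃ w : ℂ, iteratedDeriv (j + 1) f w = 0 ∧ w.im ≠ 0 ∧ NestedStep a w) ∨ (∃ x : ℝ, |x - a.re| ≤ a.im ∧ NLEventOf f j x) := by
  classical
  by_cases hnz : iteratedDeriv j f = 0
  · left
    refine ⟨a, ?_, hapos.ne', ?_⟩
    · rw [iteratedDeriv_succ, hnz]; simp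
    · show (a.re - a.re) ^ 2 + a.im ^ 2 ≤ a.im ^ 2
      simp
  have hf : RealEntireLt2 f := realEntireLt2_of_hyps hE
  have hGd : Differentiable ℂ (iteratedDeriv j f) := differentiable_iteratedDeriv_of_entire hf.diff j
  have hGreal : ∀ x : ℝ, (iteratedDeriv j f x).im = 0 := im_iteratedDeriv_ofReal hf.diff hf.real j
  obtain ⟨d0, hd0, E, hEfin, hnet⟩ := hN
  refine pinning_of_arcCount_cofinite hE ha hapos ⟨d0, hd0, E, hEfin, fun δ hδ => ?_⟩
  obtain ⟨hfinA, hle⟩ := hnet δ hδ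
  refine ⟨hfinA, ?_⟩
  have h4 := four_le_nonrealZeroMult hGd hnz hGreal ha hapos hv hvpos hva hvin hδ.1.1
  have hle' : ((ascStarts f j a δ).ncard : ℤ) ≤ (descStarts f j a δ).ncard + 1 := by exact_mod_cast hle
  linarith

/-! ## §4 The glued split of the residual -/

/-- An interior point of `a`ʼs closed Jensen circle region is a `NestedStep` child position. -/
theorem nestedStep_of_norm_le {a v : ℂ} (hvin : ‖v - (a.re : ℂ)‖ ≤ a.im) : NestedStep a v := by
  unfold NestedStep
  have e : ‖v - (a.re : ℂ)‖ ^ 2 = (v.re - a.re) ^ 2 + v.im ^ 2 := by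
    rw [Complex.sq_norm, Complex.normSq_apply]; simp; ring
  rw [← e]
  exact pow_le_pow_left₀ (norm_nonneg _) hvin 2

/-- ★ THE ATOMIC BRANCH: the net law pays the atomic class (multiple `a` or multiple `v` ⇒ that point is itself the child). -/
theorem pinning_of_atomic (hL : AtomicNetLawQ) {η : ℝ} {f : ℂ → ℂ} {x₀ s hmax R Hs : ℝ} {B : ℕ} (hE : EngineHyps5 2 η f x₀ s hmax R Hs B)
    {j : ℕ} {a v : ℂ} (ha : iteratedDeriv j f a = 0) (hapos : 0 < a.im) (hN : NoTallerToucher f j a) (hA : Atomic f j a v) :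
    (∃ w : ℂ, iteratedDeriv (j + 1) f w = 0 ∧ w.im ≠ 0 ∧ NestedStep a w) ∨ (∃ x : ℝ, |x - a.re| ≤ a.im ∧ NLEventOf f j x) := by
  by_cases hda : iteratedDeriv (j + 1) f a = 0
  · exact Or.inl ⟨a, hda, hapos.ne', by show (a.re - a.re) ^ 2 + a.im ^ 2 ≤ a.im ^ 2; simp⟩
  by_cases hdv : iteratedDeriv (j + 1) f v = 0
  · exact Or.inl ⟨v, hdv, hA.2.1.ne', nestedStep_of_norm_le hA.2.2.2.1⟩
  exact pinning_of_netLeOne hE ha hapos hA.1 hA.2.1 hA.2.2.1 hA.2.2.2.1 (hL η f x₀ s hmax R Hs B hE j a v ha hapos hN hA hda hdv)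

/-- ★★ THE GLUED SPLIT (net form): the atomic net law and the non-atomic residual give part Iʼs residual. -/
theorem topPinningResidual_of_netSplit (hL : AtomicNetLawQ) (hR : NonAtomicTopResidualQ) : TopPinningNonNestedAscResidual := by
  intro η f x₀ s hmax R Hs B hE j a ha hapos hN hJ hS hA hM hnest
  by_cases hat : ∃ v : ℂ, Atomic f j a v
  · obtain ⟨v, hv⟩ := hat
    exact pinning_of_atomic hL hE ha hapos hN hv
  · push Not at hat
    exact hR η f x₀ s hmax R Hs B hE j a ha hapos hN hJ hS hA hM hnest hat

/-- ★★★ THE GLUED SPLIT: `AtomicShapeLawQ → NonAtomicTopResidualQ → TopPinningNonNestedAscResidual`. -/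
theorem topPinningResidual_of_split (hL : AtomicShapeLawQ) (hR : NonAtomicTopResidualQ) : TopPinningNonNestedAscResidual :=
  topPinningResidual_of_netSplit (atomicNetLaw_of_atomicShapeLaw hL) hR

/-- … hence `TopPinning` (part I). -/
theorem topPinning_of_split (hL : AtomicShapeLawQ) (hR : NonAtomicTopResidualQ) : TopPinning :=
  topPinning_of_nonNestedAscResidual (topPinningResidual_of_split hL hR)

/-- Converse bookkeeping: the non-atomic residual is a sub-case of the law (the atomic SHAPE law is NOT — it is strictly stronger on its class). -/
theorem nonAtomicResidual_of_topPinning (hP : TopPinning) : NonAtomicTopResidualQ :=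
  fun η f x₀ s hmax R Hs B hE j a ha hapos hN _ _ _ _ _ _ => hP η f x₀ s hmax R Hs B hE j a ha hapos hN

/-- In the residual the atomic mate, when it exists, is THE mate: `¬ JensenIsolated` produces a mate and `Atomic` makes it unique. -/
theorem atomic_mate_unique {f : ℂ → ℂ} {j : ℕ} {a v : ℂ} (hA : Atomic f j a v) : ∀ c, IsMate f j a c ↔ c = v :=
  fun _ => ⟨fun hc => eq_of_isMate_of_atomic hA hc, fun h => h ▸ isMate_of_atomic hA⟩

/-! ## §5 PIN-P3: the central-child candidate for clusters `P ≥ 3` (statement only) -/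

/-- ☆ CANDIDATE LAW «PIN-P3» (STATEMENT ONLY — binder of nothing; SUMMON (O7-3)).  On a legal frame, a top upper zero `a` of `f^{(j)}` with TWO
DISTINCT INTERIOR mates `v ≠ u` (`‖v − Re a‖ ≤ Im a`, `‖u − Re a‖ ≤ Im a`; cluster size `P ≥ 3`) whose small circles are NOT net-non-ascending
(the `K < 0` proxy of the residual) has a NON-REAL zero of `f^{(j+1)}` in its CLOSED Jensen disc — the FIRST disjunct of the law, no NL escape needed.
FIRST INSTANCE (C6 g38, frame W7): `a = i`, `v = 0.55 + 0.81 i`, `u = 0.81 + 0.54 i`, no teeth, background weight `g = −12`: `#asc = 2` in the lens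
`J_v` for `g ∈ (−19.46, −8.48)` (so SHAPE v2 fails there), yet the central child `w ≈ 0.0637 + 0.9882 i` of the cluster lies in `D̄_a`.  C6ʼs closed
form for the atomic central child (`z_c = m + G − s √(G² + d²)`, `m = (a+v)/2`, `d = (a−v)/2`, `G = −1/F(m)`) is recorded in the gen-7 memo, not typed.
Why it might fail: a far exterior field (teeth / a heavy pair outside the column) can drag the clusterʼs children out of `D̄_a` while keeping `K < 0`
(no census of that regime yet). -/
def CentralChildDiscQ : Prop :=
  ∀ (η : ℝ) (f : ℂ → ℂ) (x₀ s hmax R Hs : ℝ) (B : ℕ), EngineHyps5 2 η f x₀ s hmax R Hs B → ∀ (j : ℕ) (a v u : ℂ),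
    iteratedDeriv j f a = 0 → 0 < a.im → NoTallerToucher f j a → IsMate f j a v → IsMate f j a u → v ≠ u →
    ‖v - (a.re : ℂ)‖ ≤ a.im → ‖u - (a.re : ℂ)‖ ≤ a.im → ¬ ArcNetNonAsc f j a →
    ∃ w : ℂ, iteratedDeriv (j + 1) f w = 0 ∧ w.im ≠ 0 ∧ NestedStep a w

/-- PIN-P3 pays its class inside `NonAtomicTopResidualQ` (bookkeeping only; the class with an exterior mate or an on-chain third zero is not covered). -/
theorem nonAtomic_twoInteriorMates_of_centralChild (hC : CentralChildDiscQ) {η : ℝ} {f : ℂ → ℂ} {x₀ s hmax R Hs : ℝ} {B : ℕ}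
    (hE : EngineHyps5 2 η f x₀ s hmax R Hs B) {j : ℕ} {a v u : ℂ} (ha : iteratedDeriv j f a = 0) (hapos : 0 < a.im)
    (hN : NoTallerToucher f j a) (hv : IsMate f j a v) (hu : IsMate f j a u) (hvu : v ≠ u) (hvin : ‖v - (a.re : ℂ)‖ ≤ a.im)
    (huin : ‖u - (a.re : ℂ)‖ ≤ a.im) (hM : ¬ ArcNetNonAsc f j a) :
    (∃ w : ℂ, iteratedDeriv (j + 1) f w = 0 ∧ w.im ≠ 0 ∧ NestedStep a w) ∨ (∃ x : ℝ, |x - a.re| ≤ a.im ∧ NLEventOf f j x) :=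
  Or.inl (hC η f x₀ s hmax R Hs B hE j a v u ha hapos hN hv hu hvu hvin huin hM)

end RhW08.Lens1ArcSign
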